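import Mathlib

/-!
# Venture HSemireg — FORMULA-N typed statements (th-6): Hankel law, rank-2 cases, FN4_classLevel

HONEST FRAMING. Part of the Lean index of the computation cell `pub-hsemireg` (seat p3; Sunday enclosure of the
FORMULA-N kernel assets of seats th-7 / th-6, ENCLOSURE-PLAN-p3.md).  Finite-dimensional exterior algebra over a field ONLY:
no variety, no cohomology theory, no semiregularity map is constructed here; nothing here says that HC / HC_CM / HC_AV holds;
no Literature fact is declared or used.  The geometric DICTIONARY (why these ranks are the `HT`-side box ranks of the cell's
STRUCTURE.md §1 / theory/FORMULA-N.md) lives in theory/FORMULA-N-th7.md PART B §A.3 / §N and is NOT asserted in Lean.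

th-6's TYPED STATEMENT FILE (theory/th6/HankelLawStatement.lean v2 sha256/16 4e446e6484457192), VERBATIM up to the namespace
(`HSemiregFormulaN` ↦ `Summit.Ventures.HSemireg.FormulaN`): `Prop`-valued DEFINITIONS ONLY (no theorem) of the finite-dimensional
exterior-algebra content of FORMULA-N PART A §2.6 THEOREM H («Hankel / catalecticant law») and of its Hankel-rank-2 cases THEOREM T
(§2.2), in the combinatorial model of the cell's exact code theory/th6/fn_model.py: generators `Gen n := Fin n ⊕ Fin n` (`inl a` ↦ the
polyvector `∂_a`, `inr a` ↦ the (0,1)-form `dz̄_a`), `HT := ⋀(Gen n → K)`, `elemClass m = E_m := Σ_{|S| = m} Π_a (dz̄_a if a ∈ S else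
∂_a)` (ordered product; the class of `Θ^m/m!` divided by the volume form), `vClass q := Σ_m q_m • E_m`, `wedgeWith k q := θ ↦ θ ∧
vClass q` on `⋀^k`, `hankel k q := (q_{s+j})`, the laws `HankelLawAt`, `HankelLaw`, `TransversePairLawAt`, `PointPairLawAt`, and the
conjunction `FN4_classLevel` offered to STRUCTURE.md §(1)/(2).  PROVED ELSEWHERE: `HankelLawAt`/`HankelLaw` in `WedgeHankelGlue.lean`
(th-7), `PointPairLawAt`/`TransversePairLawAt` in `WedgePairGlue.lean`/`WedgePairShear.lean` (th-7) — over EVERY field: the proofs are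
characteristic-free and do not use the `[CharZero K]` binders of `HankelLaw` / `FN4_classLevel`, which are kept verbatim.  th-6's model docstring follows.

Model (FORMULA-N §2.1/§2.6): an abelian n-fold X with a non-degenerate (1,1)-class Θ has
HT^k(X) = ⋀^k N, N = V ⊕ V̄^*, with a Θ-symplectic basis ∂_a ∈ V, dz̄_a ∈ V̄^* (a < n); the class
Θ^m/m! corresponds (after dividing by the volume form) to the elementary element
E_m = Σ_{|S| = m} Π_a (dz̄_a if a ∈ S else ∂_a) (ordered product over a = 0, …, n-1), and a class
v = Σ_m q_m Θ^m/m! ∈ ℂ[Θ] to `vClass q = Σ_m q_m • E_m`.  Contraction θ ↦ θ ⌟ v becomes left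
multiplication θ ↦ θ * vClass q on ⋀^k N (ranks are sign-blind, §2.6).  THEOREM H says
  finrank (range of θ ↦ θ * vClass q on ⋀^k N) = C(n,k) · rank (q_{s+j})_{0 ≤ j ≤ k, 0 ≤ s ≤ n-k}.
-/

open scoped BigOperators

namespace Summit.Ventures.HSemireg.FormulaN

variable (K : Type*) [Field K] (n : ℕ)

/-- The 2n generators: `Sum.inl a` ↦ the polyvector ∂_a, `Sum.inr a` ↦ the (0,1)-form dz̄_a. -/
abbrev Gen : Type := Fin n ⊕ Fin n

/-- N = V ⊕ V̄^*, the free module on the 2n generators. -/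
abbrev N : Type _ := Gen n → K

/-- The exterior algebra ⋀N = HT^•(X) in the model. -/
abbrev HT : Type _ := ExteriorAlgebra K (N K n)

/-- generator ∂_a -/
noncomputable def x (a : Fin n) : HT K n := ExteriorAlgebra.ι K (Pi.single (Sum.inl a) (1 : K))
/-- generator dz̄_a -/
noncomputable def y (a : Fin n) : HT K n := ExteriorAlgebra.ι K (Pi.single (Sum.inr a) (1 : K))

/-- E_m = Σ_{S ⊆ Fin n, |S| = m} Π_{a = 0}^{n-1} (dz̄_a if a ∈ S else ∂_a)  (ordered product):
the element of ⋀^n N representing Θ^m/m! divided by the volume form. -/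
noncomputable def elemClass (m : ℕ) : HT K n :=
  ∑ S ∈ (Finset.univ : Finset (Fin n)).powersetCard m,
    ((List.finRange n).map fun a => if a ∈ S then y K n a else x K n a).prod

/-- v = Σ_{m ≤ n} q_m Θ^m/m!  ↦  Σ_m q_m • E_m. -/
noncomputable def vClass (q : ℕ → K) : HT K n :=
  ∑ m ∈ Finset.range (n + 1), q m • elemClass K n m

/-- θ ↦ θ ∧ v restricted to HT^k = ⋀^k N (values in the whole exterior algebra; the image lies in
⋀^(k+n) N but the rank does not depend on the codomain). -/
noncomputable def wedgeWith (k : ℕ) (q : ℕ → K) : (⋀[K]^k (N K n)) →ₗ[K] HT K n :=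
  (LinearMap.mulRight K (vClass K n q)).comp (⋀[K]^k (N K n)).subtype

/-- The k-th Hankel (catalecticant) matrix of the coefficient sequence: (q_{s+j})_{j ≤ k, s ≤ n-k}. -/
def hankel (k : ℕ) (q : ℕ → K) : Matrix (Fin (k + 1)) (Fin (n - k + 1)) K :=
  fun j s => q ((s : ℕ) + (j : ℕ))

/-- FORMULA-N PART A §2.6 THEOREM H (Hankel law), one degree k ≤ n:
rank(θ ↦ θ ∧ v on ⋀^k N) = C(n,k) · rank H_k(q). -/
def HankelLawAt (k : ℕ) (q : ℕ → K) : Prop :=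
  Module.finrank K (LinearMap.range (wedgeWith K n k q)) = n.choose k * (hankel K n k q).rank

/-- THEOREM H for all fields of characteristic zero (the exact code runs over ℚ(i)), all n, all k ≤ n,
all coefficient sequences. (The proof in FORMULA-N §2.6 is characteristic-free; stated here over
char 0 only because that is what the cell uses.) -/
def HankelLaw : Prop :=
  ∀ (K : Type) [Field K] [CharZero K] (n k : ℕ) (q : ℕ → K), k ≤ n → HankelLawAt K n k q

/-- The Hankel-rank-2 polynomial P_n(t) = 2(1+t)^n - 1 - t^n, coefficientwise:
r_k(n) = 2·C(n,k) - [k = 0] - [k = n]  (FORMULA-N §2.2 THEOREM T / §2.6 Kronecker dictionary). -/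
def transversePairRank (n k : ℕ) : ℕ :=
  2 * n.choose k - (if k = 0 then 1 else 0) - (if k = n then 1 else 0)

/-- FORMULA-N §2.2 THEOREM T in the model: for a two-exponential sequence q_m = A λ^m + B μ^m with
λ ≠ μ and A, B ≠ 0 (K-secant classes, real pairs; the point class 1 - pt is the μ = ∞ limit and is
stated separately below), rank on ⋀^k N is [t^k] P_n(t). -/
def TransversePairLawAt (k : ℕ) (A B lam mu : K) : Prop :=
  lam ≠ mu → A ≠ 0 → B ≠ 0 →
    Module.finrank K (LinearMap.range (wedgeWith K n k fun m => A * lam ^ m + B * mu ^ m))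
      = transversePairRank n k

/-- The point-pair case v = a·1 + b·pt (q = (a, 0, …, 0, b)), e.g. ch(I_p) = 1 - pt: same rank
[t^k] P_n(t) (FORMULA-N §2.2; EXT-NOTE's I-product calibration family). -/
def PointPairLawAt (k : ℕ) (a b : K) : Prop :=
  a ≠ 0 → b ≠ 0 → 1 ≤ n →
    Module.finrank K (LinearMap.range
      (wedgeWith K n k fun m => (if m = 0 then a else 0) + (if m = n then b else 0)))
      = transversePairRank n k

/-- FN-4 (i) as offered to STRUCTURE.md §(1)/(2): the Hankel law together with its two named
rank-2 instances.  v2 (2026-08-22, th-6 g3): the second conjunct now carries the guard `1 ≤ n →`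
(th-7 g2, bus 14:27:08Z: without it the conjunct is FALSE at n = k = 0 — Gen 0 = ∅, vClass q = (A+B)•1,
finrank = 1 ≠ transversePairRank 0 0 = 0; THEOREM T is about abelian n-folds, n ≥ 1).  With the guard the
second conjunct is VERBATIM th-7's kernel theorem `HSemiregGlue.FN4_transversePair_clause` and the third is
`HSemiregGlue.FN4_pointPair_clause` (theory/th7/PointPairGlue.lean v2 003b351f2923dd2d, rc 0, 0 sorries);
the first conjunct (HankelLaw, Hankel rank ≥ 3 included) remains a typed statement. -/
def FN4_classLevel : Prop :=
  HankelLaw ∧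
  (∀ (K : Type) [Field K] [CharZero K] (n k : ℕ) (A B lam mu : K), 1 ≤ n → k ≤ n →
      TransversePairLawAt K n k A B lam mu) ∧
  (∀ (K : Type) [Field K] [CharZero K] (n k : ℕ) (a b : K), k ≤ n → PointPairLawAt K n k a b)

end Summit.Ventures.HSemireg.FormulaN
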